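import Mathlib

/-!
# Route `FilamentSkeletonRss` · `SkeletonJ1L` (stmt-NavierStokesRegularity-23296) · registered stub `stub_clause13L`
# (= `Theses.FilamentSkeletonRss.Clause13NearStraightL`, item 23321) — brick B7(ii): the FAR-BRANCH sup bound by inward integration

Design of record for clause 13-J (tenure note `DESIGN-NOTE-28296-tenure-g22.md` §3 (I2) CAVEAT, §8 brick B7): on the OUTER part of the
exactness ball the J-averaged local growth rate of the linearised normal velocity along the slip flow is `β̄ = ¾ − w′/2 ≥ β₀ > 0` (the partners
are far, `w′ → ½`), the variation `Y` VANISHES at the ball edge, and the transport-dominated component obeys, along each filament, a linear ODE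
`w(τ)·Y′(τ) = B(τ, Y(τ)) + F(τ)` with the slip `w > 0` pointing outward and `B` AMPLIFYING outward: `⟪B(τ, Y), Y⟫ ≥ β₀‖Y‖²`.  Integrating INWARD
from the edge then gives the Γ-uniform sup bound `‖Y‖ ≤ sup‖F‖/β₀` — with NO sign condition needed inside and no Grönwall loss.

This file proves exactly that ODE lemma, in a form independent of the skeleton vocabulary (any real inner-product space, `B` any map — only
its pairing along the solution is used), for BOTH arms:
* `norm_le_of_outwardAmplified_right` — on `[a, b]` with `w > 0`, `Y(b) = 0`: `‖Y(τ)‖ ≤ M/β₀` (`‖F‖ ≤ M`);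
* `norm_le_of_outwardAmplified_left` — on `[a, b]` with `w < 0`, `Y(a) = 0`: the same (reflection `τ ↦ −τ`).
Mechanism (real induction, `IsClosed.Icc_subset_of_forall_mem_nhdsWithin`): if `‖Y(τ₀)‖ > M/β₀` then `(‖Y‖²)′ = (2/w)(⟪B Y, Y⟫ + ⟪F, Y⟫)
≥ (2/w)‖Y‖(β₀‖Y‖ − M) > 0` wherever `‖Y‖ ≥ ‖Y(τ₀)‖`, so `‖Y‖` never drops below `‖Y(τ₀)‖` on `[τ₀, b]` — contradicting `Y(b) = 0`.
* (appended) variable-rate forms with arbitrary end values — `norm_le_norm_end_of_outwardAmplified_rate`,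
  `norm_le_max_of_outwardAmplified_rate_right` — and the DAMPED twin of design note (I2) (`⟪B(Y),Y⟫ ≤ −r‖Y‖²`, `‖F‖ ≤ M·r`:
  `‖Y‖ ≤ max(‖Y(start)‖, M)`), forward (`w > 0`, data at `a`) and backward (`w < 0`, data at `b`).
`--supports stmt-NavierStokesRegularity-23296` (brick for `stub_clause13L`; equally usable by the A1G/A1R twins 28296 / 23612).
HONEST FRAMING: an elementary ODE lemma for a plan about a HYPOTHETICAL filament skeleton on the NEGATIVE side of a MODEL route; clause 13-J,
`Clause13NearStraightL` and `SkeletonJ1L` stay OPEN; nothing here bears on Navier–Stokes regularity or blow-up.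
-/

set_option linter.dupNamespace false

noncomputable section

namespace Summit.NavierStokesRegularity.NavierStokesRegularity.Theorems.Clause13OutwardAmplifiedTransport

open Set Filter
open scoped InnerProductSpace Topology

variable {E : Type*} [NormedAddCommGroup E] [InnerProductSpace ℝ E]

/-- **Inward integration, right arm.**  Let `Y` solve `w·Y′ = B(Y) + F` on `[a, b]` with `w > 0` (outward slip), outward amplification
`β₀‖Y‖² ≤ ⟪B(τ, Y(τ)), Y(τ)⟫` (`β₀ > 0`), forcing `‖F‖ ≤ M`, and `Y(b) = 0` (the variation vanishes at the ball edge).  Then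
`‖Y(τ)‖ ≤ M/β₀` on `[a, b]`. [folklore] -/
theorem norm_le_of_outwardAmplified_right {Y Y' F : ℝ → E} {B : ℝ → E → E} {w : ℝ → ℝ} {a b β₀ M : ℝ}
    (hY : ∀ τ ∈ Icc a b, HasDerivAt Y (Y' τ) τ) (hode : ∀ τ ∈ Icc a b, w τ • Y' τ = B τ (Y τ) + F τ)
    (hw : ∀ τ ∈ Icc a b, 0 < w τ) (hB : ∀ τ ∈ Icc a b, β₀ * ‖Y τ‖ ^ 2 ≤ ⟪B τ (Y τ), Y τ⟫_ℝ) (hβ : 0 < β₀)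
    (hF : ∀ τ ∈ Icc a b, ‖F τ‖ ≤ M) (hend : Y b = 0) :
    ∀ τ ∈ Icc a b, ‖Y τ‖ ≤ M / β₀ := by
  intro τ₀ hτ₀
  by_contra hgt
  push Not at hgt
  have hM : 0 ≤ M := (norm_nonneg _).trans (hF τ₀ hτ₀)
  have hMβ : 0 ≤ M / β₀ := div_nonneg hM hβ.le
  -- the superlevel set of `‖Y‖` at height `‖Y τ₀‖`
  set S : Set ℝ := {x | ‖Y τ₀‖ ≤ ‖Y x‖} with hS
  have hcont : ContinuousOn (fun x => ‖Y x‖) (Icc τ₀ b) := fun x hx =>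
    ((hY x ⟨hτ₀.1.trans hx.1, hx.2⟩).continuousAt.norm).continuousWithinAt
  have hclosed : IsClosed (S ∩ Icc τ₀ b) := by
    have h := hcont.preimage_isClosed_of_isClosed isClosed_Icc (isClosed_Ici (a := ‖Y τ₀‖))
    rw [inter_comm]
    exact h
  -- the energy grows to the right wherever `‖Y‖ ≥ ‖Y τ₀‖ (> M/β₀)`
  have hstep : ∀ x ∈ S ∩ Ico τ₀ b, S ∈ 𝓝[>] x := by
    rintro x ⟨hxS, hx⟩
    have hxI : x ∈ Icc a b := ⟨hτ₀.1.trans hx.1, hx.2.le⟩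
    have hxS' : ‖Y τ₀‖ ≤ ‖Y x‖ := hxS
    have hYx : M / β₀ < ‖Y x‖ := hgt.trans_le hxS'
    have hYpos : 0 < ‖Y x‖ := hMβ.trans_lt hYx
    -- sign of the pairing `⟪Y x, Y' x⟫`
    have hpair : 0 < ⟪Y x, Y' x⟫_ℝ := by
      have hwx := hw x hxI
      have h1 : w x * ⟪Y x, Y' x⟫_ℝ = ⟪B x (Y x), Y x⟫_ℝ + ⟪F x, Y x⟫_ℝ := by
        rw [← real_inner_smul_right, hode x hxI, inner_add_right, real_inner_comm (B x (Y x)) (Y x),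
          real_inner_comm (F x) (Y x)]
      have h2 : -(M * ‖Y x‖) ≤ ⟪F x, Y x⟫_ℝ := by
        have := abs_real_inner_le_norm (F x) (Y x)
        have h3 := hF x hxI
        have h4 : |⟪F x, Y x⟫_ℝ| ≤ M * ‖Y x‖ := this.trans (mul_le_mul_of_nonneg_right h3 (norm_nonneg _))
        linarith [neg_abs_le ⟪F x, Y x⟫_ℝ]
      have h5 : β₀ * ‖Y x‖ ^ 2 - M * ‖Y x‖ ≤ w x * ⟪Y x, Y' x⟫_ℝ := by linarith [hB x hxI]
      have h6 : 0 < β₀ * ‖Y x‖ ^ 2 - M * ‖Y x‖ := by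
        have h7 : M < β₀ * ‖Y x‖ := by rwa [div_lt_iff₀ hβ, mul_comm] at hYx
        nlinarith
      exact pos_of_mul_pos_right (h6.trans_le h5) hwx.le  -- careful with argument order
    -- derivative of `‖Y‖²` at `x` is positive, so `‖Y‖²` exceeds its value at `x` just to the right
    have hd : HasDerivAt (fun y => ‖Y y‖ ^ 2) (2 * ⟪Y x, Y' x⟫_ℝ) x := (hY x hxI).norm_sq
    have hslope : ∀ᶠ y in 𝓝[>] x, 0 < slope (fun y => ‖Y y‖ ^ 2) x y := by
      have ht := (hd.tendsto_slope).mono_left (nhdsWithin_mono x fun s hs => (ne_of_gt hs : s ≠ x))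
      exact ht.eventually (lt_mem_nhds (by positivity))
    filter_upwards [hslope, self_mem_nhdsWithin] with y hy hyx
    have hyx' : 0 < y - x := sub_pos.2 hyx
    rw [slope_def_field] at hy
    have hsq : ‖Y x‖ ^ 2 < ‖Y y‖ ^ 2 := by
      have := mul_pos hy hyx'
      rw [div_mul_cancel₀ _ hyx'.ne'] at this
      linarith
    show ‖Y τ₀‖ ≤ ‖Y y‖
    nlinarith [norm_nonneg (Y y), norm_nonneg (Y x), norm_nonneg (Y τ₀)]
  -- real induction: `‖Y‖ ≥ ‖Y τ₀‖` on all of `[τ₀, b]`, absurd at `b`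
  have hsub : Icc τ₀ b ⊆ S := hclosed.Icc_subset_of_forall_mem_nhdsWithin
    (show τ₀ ∈ S from (le_rfl : ‖Y τ₀‖ ≤ ‖Y τ₀‖)) hstep
  have hb : ‖Y τ₀‖ ≤ ‖Y b‖ := hsub ⟨hτ₀.2, le_rfl⟩
  rw [hend, norm_zero] at hb
  linarith [norm_nonneg (Y τ₀)]

/-- **Inward integration, left arm** (`w < 0`, the variation vanishes at the LEFT edge `Y(a) = 0`): the same bound, by the reflection
`τ ↦ −τ`, `w ↦ −w(−τ)`, which preserves the form `w·Y′ = B(Y) + F`. [folklore] -/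
theorem norm_le_of_outwardAmplified_left {Y Y' F : ℝ → E} {B : ℝ → E → E} {w : ℝ → ℝ} {a b β₀ M : ℝ}
    (hY : ∀ τ ∈ Icc a b, HasDerivAt Y (Y' τ) τ) (hode : ∀ τ ∈ Icc a b, w τ • Y' τ = B τ (Y τ) + F τ)
    (hw : ∀ τ ∈ Icc a b, w τ < 0) (hB : ∀ τ ∈ Icc a b, β₀ * ‖Y τ‖ ^ 2 ≤ ⟪B τ (Y τ), Y τ⟫_ℝ) (hβ : 0 < β₀)
    (hF : ∀ τ ∈ Icc a b, ‖F τ‖ ≤ M) (hend : Y a = 0) :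
    ∀ τ ∈ Icc a b, ‖Y τ‖ ≤ M / β₀ := by
  intro τ₀ hτ₀
  -- reflected data on `[-b, -a]`
  have hmem : ∀ s ∈ Icc (-b) (-a), -s ∈ Icc a b := fun s hs => ⟨by linarith [hs.2], by linarith [hs.1]⟩
  have hYr : ∀ s ∈ Icc (-b) (-a), HasDerivAt (fun s => Y (-s)) (-(Y' (-s))) s := fun s hs => by
    have h : HasDerivAt (fun s => Y (-s)) ((-1 : ℝ) • Y' (-s)) s := (hY (-s) (hmem s hs)).scomp s (hasDerivAt_neg s)
    exact h.congr_deriv (by simp)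
  have h := norm_le_of_outwardAmplified_right (Y := fun s => Y (-s)) (Y' := fun s => -(Y' (-s))) (F := fun s => F (-s))
    (B := fun s => B (-s)) (w := fun s => -w (-s)) (a := -b) (b := -a) (β₀ := β₀) (M := M) hYr
    (fun s hs => by simpa [smul_neg, neg_smul] using hode (-s) (hmem s hs))
    (fun s hs => by simpa using hw (-s) (hmem s hs)) (fun s hs => hB (-s) (hmem s hs)) hβ
    (fun s hs => hF (-s) (hmem s hs)) (by simpa using hend) (-τ₀) ⟨by linarith [hτ₀.2], by linarith [hτ₀.1]⟩
  simpa using h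

/-! ## Variable-rate forms and the DAMPED twin (appended 2026-08-31, same hand)
Design note (I2) uses the bound with the forcing measured in units of the local rate: along the slip flow the ratio `q = ρ/μ` is DAMPED at the
variable rate `2/Aa` and `sup q ≤ max(q(waist), sup (forcing/rate))`; the outer-region step uses AMPLIFICATION at rate `β̄ ≥ β₀`.  Both are the
same real-induction argument; here are the variable-rate statements (rate `r(τ) > 0`, `‖F‖ ≤ M·r`), with arbitrary end values. -/

/-- Core step, variable rate: if `w·Y′ = B(Y) + F` on `[a, b]` with `w > 0`, `⟪B(Y), Y⟫ ≥ r‖Y‖²`, `‖F‖ ≤ M·r`, `r > 0`, then from any point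
`τ₀` where `‖Y(τ₀)‖ > M` the norm never drops below `‖Y(τ₀)‖` to the right; in particular `‖Y(τ₀)‖ ≤ ‖Y(b)‖`. [folklore] -/
theorem norm_le_norm_end_of_outwardAmplified_rate {Y Y' F : ℝ → E} {B : ℝ → E → E} {w r : ℝ → ℝ} {a b M : ℝ}
    (hY : ∀ τ ∈ Icc a b, HasDerivAt Y (Y' τ) τ) (hode : ∀ τ ∈ Icc a b, w τ • Y' τ = B τ (Y τ) + F τ)
    (hw : ∀ τ ∈ Icc a b, 0 < w τ) (hB : ∀ τ ∈ Icc a b, r τ * ‖Y τ‖ ^ 2 ≤ ⟪B τ (Y τ), Y τ⟫_ℝ) (hr : ∀ τ ∈ Icc a b, 0 < r τ)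
    (hF : ∀ τ ∈ Icc a b, ‖F τ‖ ≤ M * r τ) {τ₀ : ℝ} (hτ₀ : τ₀ ∈ Icc a b) (hgt : M < ‖Y τ₀‖) :
    ‖Y τ₀‖ ≤ ‖Y b‖ := by
  have hM : 0 ≤ M := by
    have h1 := (norm_nonneg _).trans (hF τ₀ hτ₀)
    have h2 := hr τ₀ hτ₀
    nlinarith
  set S : Set ℝ := {x | ‖Y τ₀‖ ≤ ‖Y x‖} with hS
  have hcont : ContinuousOn (fun x => ‖Y x‖) (Icc τ₀ b) := fun x hx =>
    ((hY x ⟨hτ₀.1.trans hx.1, hx.2⟩).continuousAt.norm).continuousWithinAt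
  have hclosed : IsClosed (S ∩ Icc τ₀ b) := by
    have h := hcont.preimage_isClosed_of_isClosed isClosed_Icc (isClosed_Ici (a := ‖Y τ₀‖))
    rw [inter_comm]
    exact h
  have hstep : ∀ x ∈ S ∩ Ico τ₀ b, S ∈ 𝓝[>] x := by
    rintro x ⟨hxS, hx⟩
    have hxI : x ∈ Icc a b := ⟨hτ₀.1.trans hx.1, hx.2.le⟩
    have hxS' : ‖Y τ₀‖ ≤ ‖Y x‖ := hxS
    have hYx : M < ‖Y x‖ := hgt.trans_le hxS'
    have hYpos : 0 < ‖Y x‖ := hM.trans_lt hYx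
    have hrx := hr x hxI
    have hpair : 0 < ⟪Y x, Y' x⟫_ℝ := by
      have hwx := hw x hxI
      have h1 : w x * ⟪Y x, Y' x⟫_ℝ = ⟪B x (Y x), Y x⟫_ℝ + ⟪F x, Y x⟫_ℝ := by
        rw [← real_inner_smul_right, hode x hxI, inner_add_right, real_inner_comm (B x (Y x)) (Y x),
          real_inner_comm (F x) (Y x)]
      have h2 : -(M * r x * ‖Y x‖) ≤ ⟪F x, Y x⟫_ℝ := by
        have h4 : |⟪F x, Y x⟫_ℝ| ≤ M * r x * ‖Y x‖ :=
          (abs_real_inner_le_norm (F x) (Y x)).trans (mul_le_mul_of_nonneg_right (hF x hxI) (norm_nonneg _))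
        linarith [neg_abs_le ⟪F x, Y x⟫_ℝ]
      have h5 : r x * ‖Y x‖ ^ 2 - M * r x * ‖Y x‖ ≤ w x * ⟪Y x, Y' x⟫_ℝ := by linarith [hB x hxI]
      have h6 : 0 < r x * ‖Y x‖ ^ 2 - M * r x * ‖Y x‖ := by
        have : r x * ‖Y x‖ ^ 2 - M * r x * ‖Y x‖ = r x * ‖Y x‖ * (‖Y x‖ - M) := by ring
        rw [this]
        exact mul_pos (mul_pos hrx hYpos) (by linarith)
      exact pos_of_mul_pos_right (h6.trans_le h5) hwx.le
    have hd : HasDerivAt (fun y => ‖Y y‖ ^ 2) (2 * ⟪Y x, Y' x⟫_ℝ) x := (hY x hxI).norm_sq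
    have hslope : ∀ᶠ y in 𝓝[>] x, 0 < slope (fun y => ‖Y y‖ ^ 2) x y := by
      have ht := (hd.tendsto_slope).mono_left (nhdsWithin_mono x fun s hs => (ne_of_gt hs : s ≠ x))
      exact ht.eventually (lt_mem_nhds (by positivity))
    filter_upwards [hslope, self_mem_nhdsWithin] with y hy hyx
    have hyx' : 0 < y - x := sub_pos.2 hyx
    rw [slope_def_field] at hy
    have hsq : ‖Y x‖ ^ 2 < ‖Y y‖ ^ 2 := by
      have := mul_pos hy hyx'
      rw [div_mul_cancel₀ _ hyx'.ne'] at this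
      linarith
    show ‖Y τ₀‖ ≤ ‖Y y‖
    nlinarith [norm_nonneg (Y y), norm_nonneg (Y x), norm_nonneg (Y τ₀)]
  have hsub : Icc τ₀ b ⊆ S := hclosed.Icc_subset_of_forall_mem_nhdsWithin
    (show τ₀ ∈ S from (le_rfl : ‖Y τ₀‖ ≤ ‖Y τ₀‖)) hstep
  exact hsub ⟨hτ₀.2, le_rfl⟩

/-- **Outward-amplified, variable rate, arbitrary end value (right arm):** `‖Y(τ)‖ ≤ max ‖Y(b)‖ M`. [folklore] -/
theorem norm_le_max_of_outwardAmplified_rate_right {Y Y' F : ℝ → E} {B : ℝ → E → E} {w r : ℝ → ℝ} {a b M : ℝ}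
    (hY : ∀ τ ∈ Icc a b, HasDerivAt Y (Y' τ) τ) (hode : ∀ τ ∈ Icc a b, w τ • Y' τ = B τ (Y τ) + F τ)
    (hw : ∀ τ ∈ Icc a b, 0 < w τ) (hB : ∀ τ ∈ Icc a b, r τ * ‖Y τ‖ ^ 2 ≤ ⟪B τ (Y τ), Y τ⟫_ℝ) (hr : ∀ τ ∈ Icc a b, 0 < r τ)
    (hF : ∀ τ ∈ Icc a b, ‖F τ‖ ≤ M * r τ) :
    ∀ τ ∈ Icc a b, ‖Y τ‖ ≤ max ‖Y b‖ M := by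
  intro τ₀ hτ₀
  rcases le_or_gt ‖Y τ₀‖ M with h | h
  · exact h.trans (le_max_right _ _)
  · exact (norm_le_norm_end_of_outwardAmplified_rate hY hode hw hB hr hF hτ₀ h).trans (le_max_left _ _)

/-- **DAMPED twin, forward along the flow (right arm):** `w·Y′ = B(Y) + F` on `[a, b]` with `w > 0`, DAMPING `⟪B(Y), Y⟫ ≤ −r‖Y‖²`
(`r > 0`, e.g. `r = 2/Aa` for the ratio `ρ/μ` of design note (I2)) and `‖F‖ ≤ M·r`: `‖Y(τ)‖ ≤ max ‖Y(a)‖ M` — the displacement measured in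
core radii never exceeds its waist value or the forcing-to-rate ratio.  (Reflection `τ ↦ −τ` of the amplified case.) [folklore] -/
theorem norm_le_max_of_damped_rate_forward {Y Y' F : ℝ → E} {B : ℝ → E → E} {w r : ℝ → ℝ} {a b M : ℝ}
    (hY : ∀ τ ∈ Icc a b, HasDerivAt Y (Y' τ) τ) (hode : ∀ τ ∈ Icc a b, w τ • Y' τ = B τ (Y τ) + F τ)
    (hw : ∀ τ ∈ Icc a b, 0 < w τ) (hB : ∀ τ ∈ Icc a b, ⟪B τ (Y τ), Y τ⟫_ℝ ≤ -(r τ * ‖Y τ‖ ^ 2)) (hr : ∀ τ ∈ Icc a b, 0 < r τ)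
    (hF : ∀ τ ∈ Icc a b, ‖F τ‖ ≤ M * r τ) :
    ∀ τ ∈ Icc a b, ‖Y τ‖ ≤ max ‖Y a‖ M := by
  intro τ₀ hτ₀
  have hmem : ∀ s ∈ Icc (-b) (-a), -s ∈ Icc a b := fun s hs => ⟨by linarith [hs.2], by linarith [hs.1]⟩
  have hYr : ∀ s ∈ Icc (-b) (-a), HasDerivAt (fun s => Y (-s)) (-(Y' (-s))) s := fun s hs => by
    have h : HasDerivAt (fun s => Y (-s)) ((-1 : ℝ) • Y' (-s)) s := (hY (-s) (hmem s hs)).scomp s (hasDerivAt_neg s)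
    exact h.congr_deriv (by simp)
  -- reflected equation: `w(−s)·(−Y′(−s))·… = (−B)(Y) + (−F)` with `w(−s) > 0`, amplified at rate `r(−s)`
  have h := norm_le_max_of_outwardAmplified_rate_right (Y := fun s => Y (-s)) (Y' := fun s => -(Y' (-s)))
    (F := fun s => -(F (-s))) (B := fun s y => -(B (-s) y)) (w := fun s => w (-s)) (r := fun s => r (-s))
    (a := -b) (b := -a) (M := M) hYr
    (fun s hs => by
      have := hode (-s) (hmem s hs)
      simp only [smul_neg, this, neg_add])
    (fun s hs => hw (-s) (hmem s hs))
    (fun s hs => by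
      have := hB (-s) (hmem s hs)
      rw [inner_neg_left]; linarith)
    (fun s hs => hr (-s) (hmem s hs))
    (fun s hs => by simpa using hF (-s) (hmem s hs)) (-τ₀) ⟨by linarith [hτ₀.2], by linarith [hτ₀.1]⟩
  simpa using h

/-- **DAMPED twin, backward arm (`w < 0`, data at the right end `b`):** `‖Y(τ)‖ ≤ max ‖Y(b)‖ M`.  (The left arm of a filament: the slip
points to decreasing `τ`, so «forward along the flow» starts at `b`.) [folklore] -/
theorem norm_le_max_of_damped_rate_backward {Y Y' F : ℝ → E} {B : ℝ → E → E} {w r : ℝ → ℝ} {a b M : ℝ}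
    (hY : ∀ τ ∈ Icc a b, HasDerivAt Y (Y' τ) τ) (hode : ∀ τ ∈ Icc a b, w τ • Y' τ = B τ (Y τ) + F τ)
    (hw : ∀ τ ∈ Icc a b, w τ < 0) (hB : ∀ τ ∈ Icc a b, ⟪B τ (Y τ), Y τ⟫_ℝ ≤ -(r τ * ‖Y τ‖ ^ 2)) (hr : ∀ τ ∈ Icc a b, 0 < r τ)
    (hF : ∀ τ ∈ Icc a b, ‖F τ‖ ≤ M * r τ) :
    ∀ τ ∈ Icc a b, ‖Y τ‖ ≤ max ‖Y b‖ M := by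
  intro τ₀ hτ₀
  -- `−w > 0` and the equation `(−w)·Y′ = (−B)(Y) + (−F)` is AMPLIFIED at rate `r`: apply the right-arm amplified bound directly
  have h := norm_le_max_of_outwardAmplified_rate_right (Y := Y) (Y' := Y') (F := fun s => -(F s)) (B := fun s y => -(B s y))
    (w := fun s => -(w s)) (r := r) (a := a) (b := b) (M := M) hY
    (fun s hs => by
      have := hode s hs
      rw [neg_smul, this, neg_add])
    (fun s hs => by simpa using hw s hs)
    (fun s hs => by
      have := hB s hs
      rw [inner_neg_left]; linarith)
    hr (fun s hs => by simpa using hF s hs) τ₀ hτ₀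
  simpa using h

end Summit.NavierStokesRegularity.NavierStokesRegularity.Theorems.Clause13OutwardAmplifiedTransport

end
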